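import Mathlib.Algebra.BigOperators.Group.Finset.Basic
import Mathlib.Data.Int.Order.Units
import Mathlib.Data.Fintype.Card
import Mathlib.Data.Nat.Choose.Basic
import Mathlib.Tactic.Ring
import Mathlib.Tactic.Linarith
import HarnessLib

set_option linter.dupNamespace false

/-!
# Weil-type family coverage — TYPE-III WINDOWS, part L (census block b04.24): the ALGEBRAIC SKELETON of the EVEN-RANK census (THEOREM S26)

research route conditional on HC_CM; not a corollary; Q11.4-sentence-2 already refuted in dim ≥ 3.

Ring 2, WEIL-TYPE FAMILY-COVERAGE CENSUS (`HOME/WEIL-FAMILY-COVERAGE.md` `## b04`, block b04.24, owner ring2-b04, gen 60; theory note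
`HOME/pub-hodge-ring2-b04/census-g60/theory/THEOREMS-S26.md`).  SETTING (informal, NOT formalised): the hidden factor `B` of a `G`-curve for a
type-III carrier `(G, χ)` (`f = χ(1)`, definite quaternion algebra `D`) has dimension `2k`, `k = Σ_i w(c_i) − f` (ring2-b02 THEOREM X′); gens
53–59 treated the SIXFOLDS `k = 3`; block b04.24 treats the even ranks `k = 2` (fourfolds, rows `W4.d.a`) and `k = 4` (eightfolds, rows `W8.d.a`).
Three pieces of arithmetic distinguish the ranks, and they are what this file checks in the kernel:
* the SCALING LAW of the Hasse invariant of the `2k`-dimensional Morita form `q` (THEOREMS-S26 §1, LEMMA 1″): for a bimultiplicative symmetric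
  symbol `(·,·)`, `s(λq) = s(q)·(λ,λ)^{C(2k,2)}·(λ, det q)^{2k−1}`; the pair term of that computation (`hasse_scale_pair`) and the exponent
  bookkeeping `C(2k,2) = k(2k−1) ≡ k (mod 2)`, `2k − 1` odd (`scaling_exponents_even_rank`, `rank_exponent_pred_odd`) — so the
  scaling character is `λ ↦ (λ, (−1)^k·det q)` and `s_p` is a similarity invariant exactly where `(−1)^kΔ ∈ ℚ_p^{×2}`;
* the SIGN of the signed discriminant, `e₁ = (−1)^{k(2k−1)} det = (−1)^k det` (`neg_one_pow_rank_exponent`), whence `Δ_sqf = sqf((−1)^k e₁)`;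
* the ROW LAW for general rank (THEOREMS-S26 §3 = S25 §4 remark): with `det H = (−c)^n·∏Nrd(α_i)` (`det_blocks_rank`), `det(μH) = μ^{2n}det H =
  (−d)^n det H` (`mu_pow_twice`) and the census representative `a = (−1)^n det(μH)`, one gets `a = (−(cd))^n·Δ` (`censusRep_rank`), a square times
  `Δ` for even `n` (`censusRep_rank_even`) and `−cd` times a square times `Δ` for odd `n` (`censusRep_rank_odd`); on the symbol side, for a
  `ℤˣ`-valued symbol multiplicative in its first argument, `((−c)^{2m}Δ, e) = (Δ, e)` and `((−c)^{2m+1}Δ, e) = (−1,e)(c,e)(Δ,e)`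
  (`rowLaw_symbol_rank_even/odd`): the even-rank row is `T_K = {p : (Δ,−d)_p = −1}`, the odd-rank row is S25.4's;
* the DIMENSION COUNT behind the dominance test of §5 (`typeIII_period_dim`): `dim_ℝ SO*(2k) − dim U(k) = k(2k−1) − k² = k(k−1)`, so the type-III
  special subvariety of rank `k` has complex dimension `k(k−1)/2` — a CURVE for `k = 2`.
Nothing about quaternion algebras, Hilbert symbols, Hurwitz spaces or Hodge classes is formalised; `HC_CM` is used nowhere.  No `sorry`, no
definitions.
-/

namespace Summit.HodgeConjecture.HodgeConjecture.Ring2.WeilCoverage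

/-- LEMMA 1″, pair term of the scaling law (THEOREMS-S26 §1): for a symmetric symbol `φ` multiplicative in each argument (values in any commutative
monoid), `φ(λa, λb) = φ(λ,λ)·φ(λ,ab)·φ(a,b)`.  Summed over the `C(n,2)` pairs of a diagonal form `⟨a_1,…,a_n⟩` this gives
`s(λq) = s(q)·φ(λ,λ)^{C(n,2)}·φ(λ,∏a_i)^{n−1}` (each `a_i` lies in `n − 1` pairs).
research route conditional on HC_CM; not a corollary; Q11.4-sentence-2 already refuted in dim ≥ 3. -/
theorem hasse_scale_pair {F M : Type*} [CommMonoid F] [CommMonoid M] (φ : F → F → M)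
    (h₁ : ∀ a b c, φ (a * b) c = φ a c * φ b c) (h₂ : ∀ a b c, φ a (b * c) = φ a b * φ a c) (hs : ∀ a b, φ a b = φ b a)
    (l a b : F) : φ (l * a) (l * b) = φ l l * φ l (a * b) * φ a b := by
  rw [h₁, h₂, h₂, h₂, hs a l]
  simp only [mul_comm, mul_left_comm]

/-- Exponent bookkeeping of the scaling law for EVEN rank `n = 2k`: the number of pairs is `C(2k,2) = k(2k−1)`, and `k(2k−1) ≡ k (mod 2)`
(so `φ(λ,λ)^{C(2k,2)} = φ(λ,−1)^{C(2k,2)} = φ(λ,−1)^k` for a `±1`-valued symbol).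
research route conditional on HC_CM; not a corollary; Q11.4-sentence-2 already refuted in dim ≥ 3. -/
theorem scaling_exponents_even_rank (k : ℕ) :
    (2 * k).choose 2 = k * (2 * k - 1) ∧ (2 : ℤ) ∣ (k : ℤ) * (2 * k - 1) - k := by
  refine ⟨?_, ⟨(k : ℤ) ^ 2 - k, by ring⟩⟩
  rw [Nat.choose_two_right]
  have h : 2 * k * (2 * k - 1) = 2 * (k * (2 * k - 1)) := by ring
  rw [h, Nat.mul_div_cancel_left _ (by norm_num : 0 < 2)]

/-- … and the exponent `n − 1 = 2k − 1` of `φ(λ, det)` is odd, so that factor survives: the scaling character of the Hasse invariant of a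
`2k`-dimensional form of determinant `d` is `λ ↦ φ(λ,−1)^k·φ(λ,d) = φ(λ, (−1)^k d)`.
research route conditional on HC_CM; not a corollary; Q11.4-sentence-2 already refuted in dim ≥ 3. -/
theorem rank_exponent_pred_odd (k : ℤ) : ¬ (2 : ℤ) ∣ 2 * k - 1 := by
  omega

/-- The sign of the signed discriminant in even dimension `2k`: `e₁ = (−1)^{2k(2k−1)/2}·det = (−1)^{k(2k−1)}·det = (−1)^k·det`, i.e.
`Δ_sqf = sqf((−1)^k·e₁)` (fourfolds and eightfolds: `Δ ≡ e₁`; sixfolds: `Δ ≡ −e₁`, as in gens 56–59).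
research route conditional on HC_CM; not a corollary; Q11.4-sentence-2 already refuted in dim ≥ 3. -/
theorem neg_one_pow_rank_exponent (k : ℕ) : (-1 : ℤ) ^ (k * (2 * k - 1)) = (-1) ^ k := by
  rcases k with _ | k
  · simp
  · have h : (k + 1) * (2 * (k + 1) - 1) = (k + 1) + 2 * ((k + 1) * k) := by
      have : 2 * (k + 1) - 1 = 2 * k + 1 := by omega
      rw [this]; ring
    rw [h, pow_add, pow_mul]
    simp

/-- ROW LAW for general rank `n` (THEOREMS-S26 §3): the `K`-component `H` of a diagonal skew-hermitian form `⊥⟨α_i⟩` has block determinants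
`−c·Nrd(α_i)` (part J, `rowLaw_block_det`), hence `det H = ∏(−c·N_i) = (−c)^n·∏N_i`.
research route conditional on HC_CM; not a corollary; Q11.4-sentence-2 already refuted in dim ≥ 3. -/
theorem det_blocks_rank {R : Type*} [CommRing R] (n : ℕ) (c : R) (N : Fin n → R) :
    (∏ i, (-c * N i)) = (-c) ^ n * ∏ i, N i := by
  rw [Finset.prod_mul_distrib, Finset.prod_const, Finset.card_univ, Fintype.card_fin]

/-- … the hermitian normalisation `H̃ = μH` (rank `2n` over `K`, `μ² = −d`) multiplies the determinant by `μ^{2n} = (−d)^n`.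
research route conditional on HC_CM; not a corollary; Q11.4-sentence-2 already refuted in dim ≥ 3. -/
theorem mu_pow_twice {R : Type*} [CommRing R] (μ d : R) (hμ : μ * μ = -d) (n : ℕ) : μ ^ (2 * n) = (-d) ^ n := by
  rw [pow_mul, pow_two, hμ]

/-- … so the census representative `a = (−1)^n·det(μH) = (−1)^n·(−d)^n·(−c)^n·Δ` equals `(−(cd))^n·Δ` (`Δ = ∏Nrd(α_i)`).
research route conditional on HC_CM; not a corollary; Q11.4-sentence-2 already refuted in dim ≥ 3. -/
theorem censusRep_rank {R : Type*} [CommRing R] (n : ℕ) (c d Δ : R) :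
    (-1) ^ n * ((-d) ^ n * ((-c) ^ n * Δ)) = (-(c * d)) ^ n * Δ := by
  have h : (-(c * d)) = (-1) * (-d) * (-c) := by ring
  rw [h, mul_pow, mul_pow]; ring

/-- EVEN rank `n = 2m` (fourfolds `m = 1`, eightfolds `m = 2`): `a = ((cd)^m)²·Δ` — a square times `Δ`, so `a ≡ Δ` modulo squares and the
row of the class `T_D(Δ,S)` for `K = ℚ(√−d)` is `T_K = {p : (Δ,−d)_p = −1}`: it no longer sees `D`, and it is the SPLIT row iff `Δ ∈ N(K^×)`.
research route conditional on HC_CM; not a corollary; Q11.4-sentence-2 already refuted in dim ≥ 3. -/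
theorem censusRep_rank_even {R : Type*} [CommRing R] (m : ℕ) (c d Δ : R) :
    (-(c * d)) ^ (2 * m) * Δ = ((c * d) ^ m) ^ 2 * Δ := by
  rw [pow_mul, neg_pow_two, ← pow_mul, ← pow_mul, mul_comm m 2]

/-- ODD rank `n = 2m + 1` (sixfolds `m = 1`): `a = −(cd)·((cd)^m)²·Δ`; with `d = N(μ) ∈ N(K^×)` this is S25.4's `a ≡ −c·Δ`.
research route conditional on HC_CM; not a corollary; Q11.4-sentence-2 already refuted in dim ≥ 3. -/
theorem censusRep_rank_odd {R : Type*} [CommRing R] (m : ℕ) (c d Δ : R) :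
    (-(c * d)) ^ (2 * m + 1) * Δ = -(c * d) * (((c * d) ^ m) ^ 2 * Δ) := by
  rw [pow_succ, pow_mul, neg_pow_two, ← pow_mul, ← pow_mul, mul_comm m 2]; ring

/-- Symbol side of the ROW LAW, even rank: for a `ℤˣ`-valued symbol multiplicative in its first argument (a Hilbert symbol `(·, −d)_p` at a fixed
prime), `((−c)^{2m}·Δ, e) = (Δ, e)` — squares are invisible (`u·u = 1` in `ℤˣ`).
research route conditional on HC_CM; not a corollary; Q11.4-sentence-2 already refuted in dim ≥ 3. -/
theorem rowLaw_symbol_rank_even {R : Type*} [CommRing R] (φ : R → R → ℤˣ) (h₁ : ∀ a b e, φ (a * b) e = φ a e * φ b e)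
    (m : ℕ) (c Δ e : R) : φ ((-c) ^ (2 * m) * Δ) e = φ Δ e := by
  rw [h₁, pow_mul', pow_two, h₁, Int.units_mul_self, one_mul]

/-- Symbol side of the ROW LAW, odd rank: `((−c)^{2m+1}·Δ, e) = (−1, e)·(c, e)·(Δ, e)` — S25.4's `T_K = {p : (−1,−d)_p·ε_p(D)·(Δ,−d)_p = −1}`
with `(c,−d)_p = ε_p(D)` for `D = (−d, c)_ℚ`.
research route conditional on HC_CM; not a corollary; Q11.4-sentence-2 already refuted in dim ≥ 3. -/
theorem rowLaw_symbol_rank_odd {R : Type*} [CommRing R] (φ : R → R → ℤˣ) (h₁ : ∀ a b e, φ (a * b) e = φ a e * φ b e)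
    (m : ℕ) (c Δ e : R) : φ ((-c) ^ (2 * m + 1) * Δ) e = φ (-1) e * φ c e * φ Δ e := by
  have h2 : φ ((-c) ^ (2 * m)) e = 1 := by rw [pow_mul', pow_two, h₁, Int.units_mul_self]
  have h3 : φ (-c) e = φ (-1) e * φ c e := by rw [← h₁, neg_one_mul]
  rw [h₁, pow_succ, h₁, h2, one_mul, h3]

/-- DIMENSION COUNT behind the dominance test (THEOREMS-S26 §5): `dim_ℝ SO*(2k) − dim_ℝ U(k) = k(2k−1) − k² = k(k−1)`, so the type-III special
subvariety of `D`-rank `k` has complex dimension `k(k−1)/2`: a point-free count `0` for `k = 1`, a CURVE for `k = 2` (fourfolds), a 3-fold for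
`k = 3` (sixfolds, t-2's `T_D(Δ,S)`), a 6-fold for `k = 4`; a 1-parameter Hurwitz family (`b = 4`) can dominate it only for `k ≤ 2`.
research route conditional on HC_CM; not a corollary; Q11.4-sentence-2 already refuted in dim ≥ 3. -/
theorem typeIII_period_dim (k : ℕ) : k * (2 * k - 1) - k * k = k * (k - 1) := by
  rcases k with _ | k
  · simp
  · have h1 : 2 * (k + 1) - 1 = 2 * k + 1 := by omega
    have h2 : k + 1 - 1 = k := by omega
    rw [h1, h2]
    have h3 : (k + 1) * (2 * k + 1) = (k + 1) * (k + 1) + (k + 1) * k := by ring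
    rw [h3, Nat.add_sub_cancel_left]

/-- The four instances used in the census: complex dimensions `k(k−1)/2 = 0, 1, 3, 6` for `k = 1, 2, 3, 4`, against the Hurwitz-family dimension
`b − 3 = 1` of a four-point signature.
research route conditional on HC_CM; not a corollary; Q11.4-sentence-2 already refuted in dim ≥ 3. -/
theorem typeIII_period_dim_table :
    (1 * (1 - 1) / 2 = 0 ∧ 2 * (2 - 1) / 2 = 1 ∧ 3 * (3 - 1) / 2 = 3 ∧ 4 * (4 - 1) / 2 = 6) ∧ (4 - 3 = 1) := by
  decide

end Summit.HodgeConjecture.HodgeConjecture.Ring2.WeilCoverage
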